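import Summits.QuantumAdvantage.AdviceFreeQNC0.AffBells37Resonance
import HarnessLib

/-!
# AffBells37 (5/6) — (E) the SLICE EXPANSION `ι(Wn β c (U a v)) = Σ_b coefs_b · χ_{rows_b}(v)`

Cell qa-qnc0, route DWalkThree (crux stmt-QuantumAdvantage-22907; rung (NP₁) `AffBells26.AffBellsPolyLoss3`).  AUTHORED AND PROVED BY THE PLANNER qa-qnc0-p2 gen 34 (memo `HOME/qa-qnc0-p2/ROUND-34P2.md`, INBOX P2-34a/b, 2026-08-29); landed verbatim by qn-prover-3.  Part 5/6 of the all-firsts PAIR-SLICING + `𝔽₄`-KRAFT proof of (NP₁); the six parts are a mechanical split (≤ 400 lines each) of one kernel-checked file `AffBells37.lean` (rc 0, 0 sorries, axioms propext/Classical.choice/Quot.sound).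

Geometry of the slice: `xOfU_U` (`x_i(U a v) = x_i(a) ⊕ wE ⊕ wB`), LEMMA X `ιF_xOfU_U`, LEMMA W `walkExp_U` (`e_g(U a v) ≡ e_g(a) + ⟨path_g, v⟩`),
LEMMA D `linForm_U` (`ℓ_g(x(U a v)) = ℓ_g(x(a)) + ⟨rv_g, v⟩`); then the label (`tr_label_U`), the bell (`ιF_affBell_U`), the guess
(`ιF_yOf_U`), the block identity `block` per `(g, σ)`, and `sliceExpansion : SliceExpansion`.
-/

noncomputable section

namespace Summit.QuantumAdvantage.AdviceFreeQNC0.AffBells37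

open Finset F4
open Classical

section Slicing

open Literature.Computability.QuantumComplexity Literature.Computability.QuantumComplexity.RingHLF
open AffBells23 AffBells26

variable {F : ℕ} {ι : Type*} {n : ℕ}

/-! ### (E) The slice expansion — geometry of the slice `U a v` -/

/-- generic re-indexing of an indicator sum along an injection `e` whose image carries `w = v ∘ e⁻¹`. -/
theorem sum_ite_reindex {α M : Type*} [Fintype α] [DecidableEq α] [AddCommMonoid M] {F : ℕ}
    (e : Fin F → α) (he : Function.Injective e) (w : α → Bool) (v : Fin F → Bool)
    (hw1 : ∀ j, w (e j) = v j) (hw2 : ∀ i, w i = true → ∃ j, i = e j) (G : α → M) :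
    ∑ i, (if w i = true then G i else 0) = ∑ j, (if v j = true then G (e j) else 0) := by
  have h1 : ∑ j, (if v j = true then G (e j) else 0) = ∑ i ∈ univ.image e, (if w i = true then G i else 0) := by
    rw [sum_image (fun j _ j' _ h => he h)]
    exact sum_congr rfl fun j _ => by rw [hw1]
  rw [h1]
  symm
  apply sum_subset (subset_univ _)
  intro i _ hi
  by_cases hwi : w i = true
  · obtain ⟨j, rfl⟩ := hw2 i hwi
    exact absurd (mem_image_of_mem e (mem_univ j)) hi
  · rw [if_neg hwi]
/-- Reindexing a single-coordinate indicator sum along an injective enumeration of the support. -/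
theorem sum_ite_eq_reindex {α M : Type*} [Fintype α] [DecidableEq α] [AddCommMonoid M] {F : ℕ}
    (e : Fin F → α) (he : Function.Injective e) (w : α → Bool) (v : Fin F → Bool)
    (hw1 : ∀ j, w (e j) = v j) (hw2 : ∀ i, w i = true → ∃ j, i = e j) (f : Bool → M) (hf : f false = 0) (i : α) :
    ∑ j, (if i = e j then f (v j) else 0) = f (w i) := by
  by_cases h : ∃ j, i = e j
  · obtain ⟨j, rfl⟩ := h
    rw [Finset.sum_eq_single j, if_pos rfl, hw1]
    · intro j' _ hj'
      rw [if_neg]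
      intro hh; exact hj' (he hh).symm
    · intro hh; exact absurd (mem_univ j) hh
  · have hw : w i = false := by
      cases hwi : w i
      · rfl
      · exact absurd (hw2 i hwi) h
    rw [hw, hf]
    exact sum_eq_zero fun j _ => if_neg fun hh => h ⟨j, hh⟩
/-- `fpos` is injective. -/
theorem fpos_injective : Function.Injective (fpos (n := n)) := by
  intro j j' h; have := congrArg Fin.val h; simp only [fpos] at this; exact Fin.ext (by omega)
/-- `xposA` is injective. -/
theorem xposA_injective : Function.Injective (xposA (n := n)) := by
  intro j j' h; have := congrArg Fin.val h; simp only [xposA] at this; exact Fin.ext (by omega)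
/-- `xposB` is injective. -/
theorem xposB_injective : Function.Injective (xposB (n := n)) := by
  intro j j' h; have := congrArg Fin.val h; simp only [xposB] at this; exact Fin.ext (by omega)
/-- The free-bit translate is supported on the free positions `fpos j`. -/
theorem eq_fpos_of_wOf (v : Fin (Fn n) → Bool) (i : Fin n) (h : wOf v i = true) : ∃ j, i = fpos j := by
  unfold wOf at h
  by_cases hc : i.val % 3 = 2 ∧ i.val / 3 < Fn n
  · exact ⟨⟨i.val / 3, hc.2⟩, Fin.ext (by simp only [fpos]; omega)⟩
  · rw [dif_neg hc] at h; exact absurd h (by simp)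

/-- the free-bit translate extended to all of `ℕ`. -/
def wE (v : Fin (Fn n) → Bool) (m : ℕ) : Bool := if h : m < n then wOf v ⟨m, h⟩ else false

/-- the second reading position: `x_i` also reads `u_{i-1}`. -/
def wB (v : Fin (Fn n) → Bool) (i : Fin (n + 1)) : Bool := if i.val = 0 then false else wE v (i.val - 1)

/-- The extended input of `U a v` is the extended input of `a` xor-ed with the extended free-bit pattern `wE v`. -/
theorem uExt_U (a : Fin n → Bool) (v : Fin (Fn n) → Bool) (m : ℕ) : uExt (U a v) m = xor (uExt a m) (wE v m) := by
  unfold uExt U wE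
  by_cases h : m < n
  · rw [dif_pos h, dif_pos h, dif_pos h]
  · rw [dif_neg h, dif_neg h, dif_neg h]; rfl
/-- `wE v` is supported on positions `≡ 2 (mod 3)` below `3·Fn n`. -/
theorem wE_of_true (v : Fin (Fn n) → Bool) (m : ℕ) (h : wE v m = true) : m % 3 = 2 ∧ m / 3 < Fn n := by
  unfold wE at h
  by_cases hm : m < n
  · rw [dif_pos hm] at h
    unfold wOf at h
    by_cases hc : (⟨m, hm⟩ : Fin n).val % 3 = 2 ∧ (⟨m, hm⟩ : Fin n).val / 3 < Fn n
    · exact hc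
    · rw [dif_neg hc] at h; exact absurd h (by simp)
  · rw [dif_neg hm] at h; exact absurd h (by simp)
/-- `wE v` at position `3j+2` reads `v_j`. -/
theorem wE_three (v : Fin (Fn n) → Bool) (j : Fin (Fn n)) : wE v (3 * j.val + 2) = v j := by
  have hm : 3 * j.val + 2 < n := (fpos j).isLt
  unfold wE
  rw [dif_pos hm]
  exact wOf_fpos v j
/-- `wE v` at `xposA j` reads `v_j`. -/
theorem wE_xposA (v : Fin (Fn n) → Bool) (j : Fin (Fn n)) : wE v (xposA j).val = v j := wE_three v j
/-- A position of `Fin (n+1)` in the support of `wE v` is some `xposA j`. -/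
theorem eq_xposA_of_wE (v : Fin (Fn n) → Bool) (i : Fin (n + 1)) (h : wE v i.val = true) : ∃ j, i = xposA j := by
  obtain ⟨h1, h2⟩ := wE_of_true v i.val h
  exact ⟨⟨i.val / 3, h2⟩, Fin.ext (by simp only [xposA]; omega)⟩
/-- `wB v` at `xposB j` reads `v_j`. -/
theorem wB_xposB (v : Fin (Fn n) → Bool) (j : Fin (Fn n)) : wB v (xposB j) = v j := by
  unfold wB
  rw [if_neg (by simp [xposB])]
  have : (xposB j).val - 1 = 3 * j.val + 2 := by simp [xposB]
  rw [this]
  exact wE_three v j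
/-- A position in the support of `wB v` is some `xposB j`. -/
theorem eq_xposB_of_wB (v : Fin (Fn n) → Bool) (i : Fin (n + 1)) (h : wB v i = true) : ∃ j, i = xposB j := by
  unfold wB at h
  by_cases h0 : i.val = 0
  · rw [if_pos h0] at h; exact absurd h (by simp)
  · rw [if_neg h0] at h
    obtain ⟨h1, h2⟩ := wE_of_true v _ h
    exact ⟨⟨(i.val - 1) / 3, h2⟩, Fin.ext (by simp only [xposB]; omega)⟩
/-- No position lies in the supports of both `wE v` and `wB v`. -/
theorem wE_wB_exclusive (v : Fin (Fn n) → Bool) (i : Fin (n + 1)) : ¬ (wE v i.val = true ∧ wB v i = true) := by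
  rintro ⟨h1, h2⟩
  have hA := (wE_of_true v _ h1).1
  unfold wB at h2
  by_cases h0 : i.val = 0
  · rw [if_pos h0] at h2; exact absurd h2 (by simp)
  · rw [if_neg h0] at h2
    have hB := (wE_of_true v _ h2).1
    omega

/-- **the slice moves `x` by `V`**: `x_i(U a v) = x_i(a) ⊕ wE(i) ⊕ wB(i)`. -/
theorem xOfU_U (a : Fin n → Bool) (v : Fin (Fn n) → Bool) (i : Fin (n + 1)) :
    xOfU (U a v) i = xor (xOfU a i) (xor (wE v i.val) (wB v i)) := by
  unfold xOfU wB
  simp only [uExt_U]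
  by_cases h0 : i.val = 0
  · rw [if_pos h0, if_pos h0, if_pos h0]
    cases uExt a i.val <;> cases wE v i.val <;> rfl
  · rw [if_neg h0, if_neg h0, if_neg h0]
    cases uExt a i.val <;> cases wE v i.val <;> cases uExt a (i.val - 1) <;> cases wE v (i.val - 1) <;> rfl

/-- **LEMMA X**: `ι(x_i(U a v)) = ι(x_i(a)) + Σ_j [i ∈ {3j+2, 3j+3}] ι(v_j)`. -/
theorem ιF_xOfU_U (a : Fin n → Bool) (v : Fin (Fn n) → Bool) (i : Fin (n + 1)) :
    ιF (xOfU (U a v) i) = ιF (xOfU a i) + ∑ j : Fin (Fn n), (if i = xposA j ∨ i = xposB j then ιF (v j) else 0) := by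
  rw [xOfU_U, ιF_xor, ιF_xor]
  have hsplit : ∀ j : Fin (Fn n), (if i = xposA j ∨ i = xposB j then ιF (v j) else 0)
      = (if i = xposA j then ιF (v j) else 0) + (if i = xposB j then ιF (v j) else 0) := by
    intro j
    by_cases hA : i = xposA j
    · have hB : i ≠ xposB j := by
        rw [hA]; intro h; have := congrArg Fin.val h; simp [xposA, xposB] at this
      rw [if_pos (Or.inl hA), if_pos hA, if_neg hB, add_zero]
    · by_cases hB : i = xposB j
      · rw [if_pos (Or.inr hB), if_neg hA, if_pos hB, zero_add]
      · rw [if_neg (by tauto), if_neg hA, if_neg hB, add_zero]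
  rw [Fintype.sum_congr _ _ hsplit, sum_add_distrib,
    sum_ite_eq_reindex xposA xposA_injective (fun i => wE v i.val) v (wE_xposA v) (eq_xposA_of_wE v) ιF rfl i,
    sum_ite_eq_reindex xposB xposB_injective (wB v) v (wB_xposB v) (eq_xposB_of_wB v) ιF rfl i]

/-! #### the walk exponent on a slice -/

/-- The Hamming weight cast into `ZMod 3` as an indicator sum. -/
theorem natCast_wt (u : Fin n → Bool) :
    ((_root_.Summit.QuantumAdvantage.AdviceFreeQNC0.wt u : ℕ) : ZMod 3) = ∑ i, (if u i = true then (1 : ZMod 3) else 0) := by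
  unfold _root_.Summit.QuantumAdvantage.AdviceFreeQNC0.wt
  rw [natCast_card_filter]

/-- The prefix weight cast into `ZMod 3` as an indicator sum. -/
theorem natCast_wtPrefix (u : Fin n → Bool) (g : ℕ) :
    ((wtPrefix u g : ℕ) : ZMod 3) = ∑ i, (if (i.val < g ∧ u i = true) then (1 : ZMod 3) else 0) := by
  unfold wtPrefix
  rw [natCast_card_filter]

/-- Indicator of a bit of `U a v`: base bit plus a signed free-bit correction. -/
theorem ind_U (a : Fin n → Bool) (v : Fin (Fn n) → Bool) (i : Fin n) :
    (if U a v i = true then (1 : ZMod 3) else 0) = (if a i = true then 1 else 0) + (if wOf v i = true then sg (a i) else 0) := by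
  unfold U
  cases a i <;> cases wOf v i <;> simp [sg]

/-- Prefix-restricted indicator of a bit of `U a v`: base bit plus a signed free-bit correction. -/
theorem ind_U_lt (a : Fin n → Bool) (v : Fin (Fn n) → Bool) (i : Fin n) (g : ℕ) :
    (if (i.val < g ∧ U a v i = true) then (1 : ZMod 3) else 0)
      = (if (i.val < g ∧ a i = true) then 1 else 0) + (if wOf v i = true then (if i.val < g then sg (a i) else 0) else 0) := by
  unfold U
  by_cases hg : i.val < g <;> cases a i <;> cases wOf v i <;> simp [hg, sg]

/-- **LEMMA W**: `e_g(U a v) ≡ e_g(a) + ⟨path_g, v⟩ (mod 3)`. -/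
theorem walkExp_U (a : Fin n → Bool) (v : Fin (Fn n) → Bool) (g : Fin (n + 1)) :
    ((walkExp (U a v) g.val : ℕ) : ZMod 3) = ((walkExp a g.val : ℕ) : ZMod 3) + lin (pathRow a g 1) v := by
  unfold walkExp
  push_cast
  rw [natCast_wt, natCast_wt, natCast_wtPrefix, natCast_wtPrefix]
  simp_rw [ind_U a v, ind_U_lt a v _ g.val]
  rw [sum_add_distrib, sum_add_distrib]
  have hre : ∑ i, (if wOf v i = true then sg (a i) else 0)
      + ∑ i, (if wOf v i = true then (if i.val < g.val then sg (a i) else 0) else 0) = lin (pathRow a g 1) v := by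
    rw [sum_ite_reindex fpos fpos_injective (wOf v) v (wOf_fpos v) (eq_fpos_of_wOf v) (fun i => sg (a i)),
      sum_ite_reindex fpos fpos_injective (wOf v) v (wOf_fpos v) (eq_fpos_of_wOf v)
        (fun i => if i.val < g.val then sg (a i) else 0),
      ← sum_add_distrib]
    unfold lin pathRow
    refine sum_congr rfl fun j _ => ?_
    have hval : (fpos j).val = 3 * j.val + 2 := rfl
    by_cases hv : v j = true
    · rw [if_pos hv, if_pos hv, if_pos hv, hval]
      by_cases hlt : 3 * j.val + 2 < g.val
      · rw [if_pos hlt, if_pos hlt]; ring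
      · rw [if_neg hlt, if_neg hlt]; ring
    · rw [if_neg hv, if_neg hv, if_neg hv, add_zero]
  rw [← hre]
  abel

/-! #### the affine forms on a slice -/

/-- Indicator of `xor x w` weighted by `b`: splits as the indicator of `x` plus a signed correction from `w`. -/
theorem ind_xor_right (x w : Bool) (b : ZMod 3) :
    (if xor x w = true then b else 0) = (if x = true then b else 0) + (if w = true then b * sg x else 0) := by
  cases x <;> cases w <;> simp [sg]

/-- **LEMMA D**: `ℓ_g(x(U a v)) = ℓ_g(x(a)) + ⟨rv_g, v⟩`. -/
theorem linForm_U (β : Fin (n + 1) → Fin (n + 1) → ZMod 3) (a : Fin n → Bool) (v : Fin (Fn n) → Bool) (g : Fin (n + 1)) :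
    (∑ i, if xOfU (U a v) i then β g i else 0) = (∑ i, if xOfU a i then β g i else 0) + lin (rv β a g) v := by
  have hpt : ∀ i : Fin (n + 1), (if xOfU (U a v) i = true then β g i else 0) = (if xOfU a i = true then β g i else 0)
      + ((if wE v i.val = true then β g i * sg (xOfU a i) else 0) + (if wB v i = true then β g i * sg (xOfU a i) else 0)) := by
    intro i
    rw [xOfU_U, ind_xor_right]
    congr 1
    have hex := wE_wB_exclusive v i
    cases h1 : wE v i.val <;> cases h2 : wB v i <;> simp_all
  rw [Fintype.sum_congr _ _ hpt, sum_add_distrib]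
  congr 1
  rw [sum_add_distrib,
    sum_ite_reindex xposA xposA_injective (fun i => wE v i.val) v (wE_xposA v) (eq_xposA_of_wE v)
      (fun i => β g i * sg (xOfU a i)),
    sum_ite_reindex xposB xposB_injective (wB v) v (wB_xposB v) (eq_xposB_of_wB v)
      (fun i => β g i * sg (xOfU a i)),
    ← sum_add_distrib]
  unfold lin rv
  refine sum_congr rfl fun j _ => ?_
  by_cases hv : v j = true
  · rw [if_pos hv, if_pos hv, if_pos hv]
  · rw [if_neg hv, if_neg hv, if_neg hv, add_zero]

/-! ### (E) The slice expansion — the label, the bell, the guess, the block identity -/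

/-- the unscaled path row. -/
def pathBase (a : Fin n → Bool) (g : Fin (n + 1)) (j : Fin (Fn n)) : ZMod 3 :=
  sg (a (fpos j)) * (if 3 * j.val + 2 < g.val then 2 else 1)

/-- The path row is `σ` times the path base. -/
theorem pathRow_eq (a : Fin n → Bool) (g : Fin (n + 1)) (σ : ZMod 3) : pathRow a g σ = fun j => σ * pathBase a g j := rfl

/-- `lin` of the path row is `σ` times `lin` of the path base. -/
theorem lin_pathRow (a : Fin n → Bool) (g : Fin (n + 1)) (σ : ZMod 3) (v : Fin (Fn n) → Bool) :
    lin (pathRow a g σ) v = σ * lin (pathBase a g) v := by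
  rw [pathRow_eq]; exact lin_mul σ (pathBase a g) v

/-- the base factor of block `(g, σ)`: `ω^{σE_g} χ_{σ·path_g}`. -/
def Pσ (a : Fin n → Bool) (g : Fin (n + 1)) (σ : Bool) (v : Fin (Fn n) → Bool) : F4 :=
  ωz (σv σ * Eg a g) * chiZ (pathRow a g (σv σ)) v

/-- **LEMMA LAB**: the trace of the label on the slice splits into the two `σ`-blocks. -/
theorem tr_label_U (a : Fin n → Bool) (v : Fin (Fn n) → Bool) (g : Fin (n + 1)) :
    tr (ω ^ (n + 2 + g.val + walkExp (U a v) g.val)) = ∑ σ : Bool, Pσ a g σ v := by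
  rw [← ωz_natCast]
  have hN : ((n + 2 + g.val + walkExp (U a v) g.val : ℕ) : ZMod 3) = Eg a g + lin (pathBase a g) v := by
    push_cast
    rw [walkExp_U, lin_pathRow, one_mul]
    unfold Eg
    push_cast
    ring
  rw [hN, Fintype.sum_bool]
  unfold Pσ tr
  rw [chiZ_eq_ωz, chiZ_eq_ωz, lin_pathRow, lin_pathRow, ← ωz_add, ← ωz_add, ωz_sq]
  simp only [σv, if_true, Bool.false_eq_true, if_false]
  rw [add_comm (ωz (Eg a g + lin (pathBase a g) v))]
  congr 1 <;> congr 1 <;> ring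

/-- Fourier expansion of the equality indicator `[S = t]` in `F4`. -/
theorem ιF_decide_eq (S t : ZMod 3) : ιF (decide (S = t)) = ∑ k : Fin 3, ωz (((k.val : ℕ) : ZMod 3) * (S - t)) := by
  have : decide (S = t) = decide (S - t = 0) := by simp [sub_eq_zero]
  rw [this, ιF_decide_eq_zero]

/-- the `k`-th bell character of window `g`. -/
def Bk (β : Fin (n + 1) → Fin (n + 1) → ZMod 3) (c : Fin (n + 1) → ZMod 3) (a : Fin n → Bool) (g : Fin (n + 1))
    (k : Fin 3) (v : Fin (Fn n) → Bool) : F4 :=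
  ωz (((k.val : ℕ) : ZMod 3) * Dg β c a g) * chiZ (fun j => ((k.val : ℕ) : ZMod 3) * rv β a g j) v

/-- **LEMMA BELL**: on the slice the bell is the average of three characters. -/
theorem ιF_affBell_U (β : Fin (n + 1) → Fin (n + 1) → ZMod 3) (c : Fin (n + 1) → ZMod 3) (a : Fin n → Bool)
    (v : Fin (Fn n) → Bool) (g : Fin (n + 1)) :
    ιF (affBell β c (xOfU (U a v)) g) = ∑ k : Fin 3, Bk β c a g k v := by
  unfold affBell
  rw [ιF_decide_eq, linForm_U]
  refine Fintype.sum_congr _ _ fun k => ?_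
  unfold Bk Dg
  rw [chiZ_eq_ωz, lin_mul, ← ωz_add]
  congr 1; ring

/-- the slice-expanded coordinate `ι(x_i(U a v))` as a function of `v`. -/
def Gx (a : Fin n → Bool) (v : Fin (Fn n) → Bool) (i : Fin (n + 1)) : F4 :=
  ιF (xOfU a i) + ∑ j : Fin (Fn n), (if i = xposA j ∨ i = xposB j then ω * (1 + ωz (if v j then 1 else 0)) else 0)

/-- The walk bit `x_i(U a v)` in `F4` equals the explicit expression `Gx a v i`. -/
theorem ιF_xOfU_U' (a : Fin n → Bool) (v : Fin (Fn n) → Bool) (i : Fin (n + 1)) : ιF (xOfU (U a v) i) = Gx a v i := by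
  rw [ιF_xOfU_U]
  unfold Gx
  congr 1
  refine Fintype.sum_congr _ _ fun j => ?_
  by_cases h : i = xposA j ∨ i = xposB j
  · rw [if_pos h, if_pos h, ιF_eq_omega]
  · rw [if_neg h, if_neg h]

/-- **LEMMA Y**: the strategy bit on the slice. -/
theorem ιF_yOf_U (β : Fin (n + 1) → Fin (n + 1) → ZMod 3) (c : Fin (n + 1) → ZMod 3) (a : Fin n → Bool)
    (v : Fin (Fn n) → Bool) (g : Fin (n + 1)) :
    ιF (yOf β c g (U a v)) = (∑ k : Fin 3, Bk β c a g k v) + (Gx a v g + Gx a v (nxt g)) := by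
  unfold yOf tGuess
  rw [ιF_xor, ιF_xor, ιF_affBell_U, ιF_xOfU_U', ιF_xOfU_U']

/-- **LEMMA BLOCK**: the rows and coefficients of block `(g, σ)` sum to `P_σ · ι(y_g)`-slice-part. -/
theorem block (β : Fin (n + 1) → Fin (n + 1) → ZMod 3) (c : Fin (n + 1) → ZMod 3) (a : Fin n → Bool)
    (v : Fin (Fn n) → Bool) (g : Fin (n + 1)) (σ : Bool) :
    (∑ k : Fin 3, coefs β c a (g, σ, Sum.inl k) * chiZ (rows β a (g, σ, Sum.inl k)) v)
      + ∑ t : Fin (Fn n) × Bool × Bool, coefs β c a (g, σ, Sum.inr t) * chiZ (rows β a (g, σ, Sum.inr t)) v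
      = Pσ a g σ v * ((∑ k : Fin 3, Bk β c a g k v) + (Gx a v g + Gx a v (nxt g))) := by
  have hinl : ∀ k : Fin 3, coefs β c a (g, σ, Sum.inl k) * chiZ (rows β a (g, σ, Sum.inl k)) v
      = Pσ a g σ v * Bk β c a g k v + (if k = 0 then Pσ a g σ v * (ιF (xOfU a g) + ιF (xOfU a (nxt g))) else 0) := by
    intro k
    by_cases hk : k = 0
    · subst hk
      simp only [coefs, rows, if_true]
      unfold Pσ Bk
      have h0 : chiZ (fun j => (((0 : Fin 3).val : ℕ) : ZMod 3) * rv β a g j) v = 1 := by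
        rw [chiZ_eq_ωz]; unfold lin; simp [ωz_zero]
      rw [h0, Fin.val_zero, Nat.cast_zero, zero_mul, ωz_zero]
      ring
    · simp only [coefs, rows, hk, if_false]
      unfold Pσ Bk testRow
      rw [chiZ_eq_ωz, chiZ_eq_ωz, chiZ_eq_ωz, ωz_add]
      have hl : lin (fun j => ((k.val : ℕ) : ZMod 3) * rv β a g j + pathRow a g (σv σ) j) v
          = lin (fun j => ((k.val : ℕ) : ZMod 3) * rv β a g j) v + lin (pathRow a g (σv σ)) v := by
        rw [← lin_add]; rfl
      rw [hl, ωz_add, add_zero]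
      ring
  have hinr : ∀ j : Fin (Fn n), ∀ side : Bool,
      ∑ part : Bool, coefs β c a (g, σ, Sum.inr (j, side, part)) * chiZ (rows β a (g, σ, Sum.inr (j, side, part))) v
        = Pσ a g σ v * (if tgt g side = xposA j ∨ tgt g side = xposB j then ω * (1 + ωz (if v j then 1 else 0)) else 0) := by
    intro j side
    rw [Fintype.sum_bool]
    simp only [coefs, rows, if_true, Bool.false_eq_true, if_false, add_zero]
    by_cases hc : tgt g side = xposA j ∨ tgt g side = xposB j
    · simp only [if_pos hc]
      unfold Pσ
      rw [chiZ_eq_ωz, chiZ_eq_ωz, lin_add, lin_single, ωz_add]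
      ring
    · simp only [if_neg hc]
      ring
  have hinr' : ∑ t : Fin (Fn n) × Bool × Bool, coefs β c a (g, σ, Sum.inr t) * chiZ (rows β a (g, σ, Sum.inr t)) v
      = ∑ j : Fin (Fn n), (Pσ a g σ v * (if nxt g = xposA j ∨ nxt g = xposB j then ω * (1 + ωz (if v j then 1 else 0)) else 0)
          + Pσ a g σ v * (if g = xposA j ∨ g = xposB j then ω * (1 + ωz (if v j then 1 else 0)) else 0)) := by
    rw [Fintype.sum_prod_type]
    refine Fintype.sum_congr _ _ fun j => ?_
    rw [Fintype.sum_prod_type, Fintype.sum_bool, hinr, hinr]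
    simp only [tgt, if_true, Bool.false_eq_true, if_false]
  have h3 : ∑ k : Fin 3, (if k = 0 then Pσ a g σ v * (ιF (xOfU a g) + ιF (xOfU a (nxt g))) else 0)
      = Pσ a g σ v * (ιF (xOfU a g) + ιF (xOfU a (nxt g))) := by
    rw [Fin.sum_univ_three, if_pos rfl, if_neg (by decide), if_neg (by decide), add_zero, add_zero]
  rw [Fintype.sum_congr _ _ hinl, sum_add_distrib, h3, hinr', sum_add_distrib, ← mul_sum, ← mul_sum, ← mul_sum]
  unfold Gx
  ring

/-- **(E) THE SLICE EXPANSION**. -/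
theorem sliceExpansion : SliceExpansion := by
  intro n _ β c a v
  unfold Wn
  rw [ιF_ringWinU]
  unfold ev
  rw [Fintype.sum_prod_type]
  refine Fintype.sum_congr _ _ fun g => ?_
  rw [ιF_yOf_U, tr_label_U, Fintype.sum_prod_type, mul_sum]
  refine Fintype.sum_congr _ _ fun σ => ?_
  rw [Fintype.sum_sum_type, block]
  exact mul_comm _ _

end Slicing

end Summit.QuantumAdvantage.AdviceFreeQNC0.AffBells37
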